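import Summits.CriticalPhenomena.PercolationContinuityZ3.Theorems.Transplant.AutChartCriticalContinuity
import Summits.CriticalPhenomena.PercolationContinuityZ3.Theorems.Transplant.PlanarSkeletonFrmScaledRayHolds
import Summits.CriticalPhenomena.PercolationContinuityZ3.Theorems.Transplant.PlanarSkeletonFrmFrom1Px
import HarnessLib

/-!
# The scaled one-type node `SamePDropOfSkeletonFrmScaled₁` FOLLOWS from its TIGHT (`L ≤ N`) rider form — the rider is free

builds on p205010 (kernel theorem, internal audit signed; external expert review pending).
Lane `prim-bschramm`, refuter seat p5 (gen 26); helper file (`--supports stmt-CriticalPhenomena-4575 --as helper`); PROOFS ONLY over landed theorems —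
no definition, no new statement, the `@[conjecture] SamePDropOfSkeletonFrmScaled₁` («PlanarSkeletonFrmScaledDefs» :160) is NOT edited and NOT claimed here.

WHAT THIS FILE SETTLES (a question of RULING D-Us / WAVE-Us-MANIFEST §5, not a node): the U_s node of record is the RIDER form
`… (Φ : PlanarSkeletonFrmScaled G), Φ.L ≤ Φ.N → (body of U_s)` (the coarse chart `φ / N` is 1-Lipschitz iff `L ≤ N`), and the manifest records that
after it lands "the `@[conjecture] SamePDropOfSkeletonFrmScaled₁` stays OPEN (the rider-free form needs a re-basing lemma for abstract `L > N`)".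
**It does not stay open: the rider form IMPLIES the rider-free conjecture, by theorems already in the tree.**  The re-basing lemma exists at the level of
GRAPHS (not charts): by `samePDropOfSkeletonFrmScaled₁_iff_continuity` («PlanarSkeletonFrmScaledRayHolds» :49) U_s is equivalent to `θ_t(p_c) = 0` on every
connected graph carrying a one-type `PlanarSkeletonFrmScaled` (Φ2 at `p_c`, uniqueness and `p_c < 1` being theorems of the interface); and a graph carrying a
one-type scaled skeleton `Φ` with ANY `L, N` carries ANOTHER one with `L = N`: off exponential growth, `Φ`'s chart-translating automorphisms act transitively
with a rank-two character (`AutChart.exists_oneType_skeleton_iff`, gen 24's `FrmScaledAut`) and the chart datum of `AutChart.exists_datum` (Kozma–Nitzan Lemma 8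
re-based on a maximal-area pair of movers, relative Milnor kernel lemma) yields `ChartDatum.skeleton` with `L = N` DEFINITIONALLY («AutChartCylinders» :181–:192)
— its cylinders are re-derived from scratch, so the obstruction '(κ′) does not transfer to sheared cylinders' (P5-SHARPNESS §56.7 (ii)) never arises; on
exponential growth Hutchcroft's theorem gives `θ(p_c) = 0` outright.
* §1 `tightContinuity_of_tightDrop` — the rider form gives `θ_t(p_c) = 0` for TIGHT one-type scaled skeletons (the proof of `continuity_of_frmScaledNode₁`
  with `L ≤ N` threaded; Φ2 at `p_c` from `cylSubcritical_criticalProb`).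
* §2 `samePDropOfSkeletonFrmScaled₁_of_tightContinuity` — continuity for tight skeletons ⟹ the FULL conjecture (the graph-level re-basing above);
  `samePDropOfSkeletonFrmScaled₁_of_tightDrop` (rider ⟹ U_s), `samePDropOfSkeletonFrmScaled₁_iff_tightDrop` / `…_iff_tightContinuity` (EQUIVALENCES).
* §3 `PlanarSkeletonFrmScaled.samePDropOfSkeletonFrmScaled₁_of_choiceFnNQLTKPxAt` — U_s BY NAME from a `D`-indexed family of the four GEN column obligations
  (the exact hypothesis list of «PlanarSkeletonFrmFrom1Px» `PlanarSkeletonFrmScaled.theta_criticalProbIOf_eq_zero_of_choiceFnNQLTKPxAt`): so the Us-4 node MAY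
  conclude the `@[conjecture]` itself, discharging every `(hN : SamePDropOfSkeletonFrmScaled₁)` customer in the tree by `exact`, with no customers wave.
Nothing here proves any GEN obligation; until the four GEN tops land nothing about U_s is claimed.
[cite: BenjaminiSchramm1996, Conj. 4; §2 (almost transitive graphs)] [cite: KozmaNitzan2024, §1 p. 2 (approach 1); §4 p. 16 (Lemma 8)] [cite: Hutchcroft2016, Thm. 1.1]
-/

noncomputable section

namespace Summit.CriticalPhenomena.PercolationContinuityZ3.Theorems.Transplant

open MeasureTheory SimpleGraph Literature.Probability.Percolation Literature.Probability.LatticeModels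
open Literature.Barriers.CriticalPhenomena (IsQuasiTransitive IsGraphAmenable HasExponentialGrowth
  hasExponentialGrowth_of_not_isGraphAmenable BurtonKeane1989_atMostOneInfiniteCluster_holds Hutchcroft2016_noPercolationAtCriticality_holds
  countable_of_connected_of_locallyFinite)
open scoped Classical

/-! ## §1 The rider form gives continuity at `p_c` for TIGHT skeletons -/

/-- **CONTINUITY AT `p_c` FOR TIGHT ONE-TYPE SCALED SKELETONS FROM THE RIDER FORM**: if the same-`p` drop holds for every one-type `PlanarSkeletonFrmScaled`
with `L ≤ N` (the U_s node's rider form, WAVE-Us-MANIFEST §5), then every connected locally finite graph with such a skeleton has `θ_t(p_c) = 0` at the base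
vertex — quasi-transitivity, `p_c < 1`, uniqueness at `p_c` (Hutchcroft off amenability, Burton–Keane on it) and Φ2 at `p_c` (`cylSubcritical_criticalProb`)
all come from the skeleton.  (The proof of `continuity_of_frmScaledNode₁` with `L ≤ N` threaded.)
[cite: BenjaminiSchramm1996, Conj. 4] [cite: Hutchcroft2016, Thm. 1.1] [cite: LyonsPeres2016, Thm. 7.6] -/
theorem tightContinuity_of_tightDrop
    (hR : ∀ {V : Type} [DecidableEq V] [Countable V] (G : SimpleGraph V) [G.LocallyFinite] (Φ : PlanarSkeletonFrmScaled G),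
      Φ.L ≤ Φ.N → G.Connected → ∀ t ∈ Φ.types, Φ.types = {t} → ∀ p : unitInterval, (p : ℝ) < 1 →
        (∀ᵐ ω ∂bondPercolation G p, numInfiniteClusters ω ≤ 1) → Φ.CylSubcritical p → 0 < theta G t p →
          ∃ q : unitInterval, (q : ℝ) < p ∧ 0 < theta G t q)
    {V : Type} [DecidableEq V] [Countable V] (G : SimpleGraph V) [G.LocallyFinite] (Φ : PlanarSkeletonFrmScaled G) (hLN : Φ.L ≤ Φ.N)
    (hc : G.Connected) (t : V) (ht : t ∈ Φ.types) (h1 : Φ.types = {t}) : theta G t (criticalProbIOf G t) = 0 := by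
  have hq : IsQuasiTransitive G := Φ.isQuasiTransitive_frmScaled
  by_cases hg : HasExponentialGrowth G
  · exact Hutchcroft2016_noPercolationAtCriticality_holds G hc hq hg t
  · have ha : IsGraphAmenable G := by_contra fun hna => hg (hasExponentialGrowth_of_not_isGraphAmenable G hq hna)
    have hpc : criticalProb G t < 1 := Φ.criticalProb_lt_one_frmScaled hc t
    exact theta_criticalProbIOf_eq_zero_of_drop_at G t fun hpos =>
      hR G Φ hLN hc t ht h1 _ (by exact hpc) (BurtonKeane1989_atMostOneInfiniteCluster_holds G hc hq ha _)
        (Φ.cylSubcritical_criticalProb t) hpos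

/-! ## §2 Continuity for tight skeletons gives the FULL conjecture (graph-level re-basing) -/

/-- **THE RIDER IS FREE — `SamePDropOfSkeletonFrmScaled₁` FROM CONTINUITY FOR TIGHT SKELETONS**: if every connected graph with a one-type
`PlanarSkeletonFrmScaled` having `L ≤ N` satisfies `θ_t(p_c) = 0`, then the (rider-free) scaled node `SamePDropOfSkeletonFrmScaled₁` holds.  By
`samePDropOfSkeletonFrmScaled₁_iff_continuity` it suffices to show `θ_t(p_c) = 0` for a graph with a one-type scaled skeleton `Φ` of ARBITRARY `L, N`: on
exponential growth this is Hutchcroft's theorem; off it, `Φ`'s chart-translating automorphisms act transitively on the vertices and translate a rank-two chart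
(`AutChart.exists_oneType_skeleton_iff`), so `AutChart.exists_datum` (Kozma–Nitzan's Lemma 8, re-based on a maximal-area pair of movers) equips the SAME graph
with the one-type scaled skeleton `ChartDatum.skeleton`, whose Lipschitz constant EQUALS its step length by construction — and the hypothesis applies to it.
[cite: BenjaminiSchramm1996, Conj. 4; §2] [cite: KozmaNitzan2024, §4 p. 16 (Lemma 8)] [cite: Hutchcroft2016, Thm. 1.1] [cite: MilnorSolvableGrowth1968, Lemma 1] -/
theorem samePDropOfSkeletonFrmScaled₁_of_tightContinuity
    (hK : ∀ {V : Type} [DecidableEq V] [Countable V] (G : SimpleGraph V) [G.LocallyFinite] (Φ : PlanarSkeletonFrmScaled G),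
      Φ.L ≤ Φ.N → G.Connected → ∀ t ∈ Φ.types, Φ.types = {t} → theta G t (criticalProbIOf G t) = 0) :
    SamePDropOfSkeletonFrmScaled₁ := by
  refine samePDropOfSkeletonFrmScaled₁_iff_continuity.2 ?_
  intro V _ _ G _ Φ hc t ht h1
  by_cases hG : HasExponentialGrowth G
  · exact Hutchcroft2016_noPercolationAtCriticality_holds G hc Φ.isQuasiTransitive_frmScaled hG t
  · obtain ⟨A, φ, htr, hφ, hrank⟩ := (AutChart.exists_oneType_skeleton_iff hG hc t).1 ⟨Φ, h1⟩
    letI : MulAction (G ≃g G) V := AutChart.autMulAction G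
    have hact : IsActionByAut G A := fun a x y => (a : G ≃g G).map_rel_iff'
    have htr' : ∀ w : V, ∃ a : A, a • t = w := fun w => by
      obtain ⟨α, hα, hw⟩ := htr w
      exact ⟨⟨α, hα⟩, hw⟩
    obtain ⟨D⟩ := AutChart.exists_datum hact hc htr' (AutChart.chartHom t φ (fun a w => hφ a a.2 w)) (fun h hh => by
        show Multiplicative.ofAdd (φ (h • t) - φ t) = 1
        rw [MulAction.mem_stabilizer_iff.1 hh, sub_self, ofAdd_zero]) (by
        obtain ⟨x, y, hxy⟩ := hrank
        obtain ⟨a, rfl⟩ := htr' x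
        obtain ⟨b, rfl⟩ := htr' y
        exact ⟨a, b, by rwa [AutChart.toAdd_chartHom, AutChart.toAdd_chartHom]⟩) hG
    exact hK G D.skeleton le_rfl hc t (Finset.mem_singleton_self t) rfl

/-- **THE RIDER FORM IMPLIES THE SCALED NODE**: the same-`p` drop for every TIGHT (`L ≤ N`) one-type `PlanarSkeletonFrmScaled` — the U_s node's rider form of
record (WAVE-Us-MANIFEST §5) — gives `SamePDropOfSkeletonFrmScaled₁` for ALL one-type scaled skeletons (§1 ∘ §2).  Consequently the Us-4 node, when it lands in
rider form, closes the `@[conjecture]` itself and every `_of_frmScaledNode₁` customer by `exact`; until then NOTHING about U_s is claimed.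
[cite: BenjaminiSchramm1996, Conj. 4; §2] [cite: KozmaNitzan2024, §4 p. 16 (Lemma 8)] [cite: Hutchcroft2016, Thm. 1.1] -/
theorem samePDropOfSkeletonFrmScaled₁_of_tightDrop
    (hR : ∀ {V : Type} [DecidableEq V] [Countable V] (G : SimpleGraph V) [G.LocallyFinite] (Φ : PlanarSkeletonFrmScaled G),
      Φ.L ≤ Φ.N → G.Connected → ∀ t ∈ Φ.types, Φ.types = {t} → ∀ p : unitInterval, (p : ℝ) < 1 →
        (∀ᵐ ω ∂bondPercolation G p, numInfiniteClusters ω ≤ 1) → Φ.CylSubcritical p → 0 < theta G t p →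
          ∃ q : unitInterval, (q : ℝ) < p ∧ 0 < theta G t q) :
    SamePDropOfSkeletonFrmScaled₁ :=
  samePDropOfSkeletonFrmScaled₁_of_tightContinuity fun G _ Φ hLN hc t ht h1 => tightContinuity_of_tightDrop hR G Φ hLN hc t ht h1

/-- **THE RIDER FORM IS EQUIVALENT TO THE SCALED NODE** (the converse forgets `L ≤ N`). [cite: BenjaminiSchramm1996, Conj. 4] -/
theorem samePDropOfSkeletonFrmScaled₁_iff_tightDrop : SamePDropOfSkeletonFrmScaled₁ ↔
    ∀ {V : Type} [DecidableEq V] [Countable V] (G : SimpleGraph V) [G.LocallyFinite] (Φ : PlanarSkeletonFrmScaled G),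
      Φ.L ≤ Φ.N → G.Connected → ∀ t ∈ Φ.types, Φ.types = {t} → ∀ p : unitInterval, (p : ℝ) < 1 →
        (∀ᵐ ω ∂bondPercolation G p, numInfiniteClusters ω ≤ 1) → Φ.CylSubcritical p → 0 < theta G t p →
          ∃ q : unitInterval, (q : ℝ) < p ∧ 0 < theta G t q :=
  ⟨fun h _ _ _ G _ Φ _ hc t ht h1 p hp hU hC hθ => h G Φ hc t ht h1 p hp hU hC hθ, samePDropOfSkeletonFrmScaled₁_of_tightDrop⟩

/-- **THE SCALED NODE IS EQUIVALENT TO CONTINUITY FOR TIGHT SKELETONS** — normal form of §2: `SamePDropOfSkeletonFrmScaled₁` holds iff `θ_t(p_c) = 0` on every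
connected graph with a TIGHT one-type `PlanarSkeletonFrmScaled`. [cite: BenjaminiSchramm1996, Conj. 4] -/
theorem samePDropOfSkeletonFrmScaled₁_iff_tightContinuity : SamePDropOfSkeletonFrmScaled₁ ↔
    ∀ {V : Type} [DecidableEq V] [Countable V] (G : SimpleGraph V) [G.LocallyFinite] (Φ : PlanarSkeletonFrmScaled G),
      Φ.L ≤ Φ.N → G.Connected → ∀ t ∈ Φ.types, Φ.types = {t} → theta G t (criticalProbIOf G t) = 0 :=
  ⟨fun h _ _ _ G _ Φ _ hc t ht h1 => samePDropOfSkeletonFrmScaled₁_iff_continuity.1 h G Φ hc t ht h1,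
    samePDropOfSkeletonFrmScaled₁_of_tightContinuity⟩

/-! ## §3 The scaled node BY NAME from a `D`-indexed family of the four GEN column obligations -/

namespace PlanarSkeletonFrmScaled

open PlanarSkeletonFrmFrom (ChoiceFnNQPxAt GeomHoldsNQFnPxAt RootHoldsNQWFnLKPxAt FaceHoldsRNQFnLTKPxAt ReachHoldsRHNQFnLKPxAt)

/-- **`SamePDropOfSkeletonFrmScaled₁` ITSELF FROM THE GEN COLUMN OBLIGATIONS** — the exact hypothesis list of
`PlanarSkeletonFrmScaled.theta_criticalProbIOf_eq_zero_of_choiceFnNQLTKPxAt` («PlanarSkeletonFrmFrom1Px»: a `D`-indexed family of GEN choice functions with the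
Geom / (R) root / (F) face / (C) reach obligations at every `D`), with NO `L ≤ N` rider and NO Φ2 hypothesis left in the conclusion: that theorem gives `θ_t(p_c) = 0`
for every tight one-type scaled skeleton (Φ2 at `p_c` by `cylSubcritical_criticalProb`), and §2 removes the rider.  The Us-4 node may therefore be typed as
`theorem samePDropOfSkeletonFrmScaled₁_holds : SamePDropOfSkeletonFrmScaled₁ := samePDropOfSkeletonFrmScaled₁_of_choiceFnNQLTKPxAt … (the four GEN tops)`;
nothing about those tops is claimed here. [cite: BenjaminiSchramm1996, Conj. 4] [cite: KozmaNitzan2024, §1 p. 2 (approach 1); §4 pp. 15–31] -/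
theorem samePDropOfSkeletonFrmScaled₁_of_choiceFnNQLTKPxAt (Lf : ℕ → ℕ) (dT : ℝ → ℝ) (hdT : ∀ x : ℝ, 0 < x → 0 < dT x) (Kmin : ℕ)
    (𝒞f : ∀ D : ℕ, ChoiceFnNQPxAt D) (hGm : ∀ D, GeomHoldsNQFnPxAt (𝒞f D)) (hR : ∀ D, RootHoldsNQWFnLKPxAt Lf Kmin (𝒞f D))
    (hF : ∀ D, FaceHoldsRNQFnLTKPxAt Lf dT Kmin (𝒞f D)) (hRe : ∀ D, ReachHoldsRHNQFnLKPxAt Lf Kmin (𝒞f D)) :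
    SamePDropOfSkeletonFrmScaled₁ :=
  samePDropOfSkeletonFrmScaled₁_of_tightContinuity fun _ _ Φ hLN hc t _ h1 =>
    theta_criticalProbIOf_eq_zero_of_choiceFnNQLTKPxAt Lf dT hdT Kmin 𝒞f hGm hR hF hRe Φ hc h1 hLN (Φ.cylSubcritical_criticalProb t)

end PlanarSkeletonFrmScaled

end Summit.CriticalPhenomena.PercolationContinuityZ3.Theorems.Transplant

end
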